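/-
Copyright (c) 2026 the pub-hodgecm-mathlib formalisation cell (harness21).  Prover seat hodgecm-mathlib-LH4-p01 (g17): STAGE 1a «(D-RAM) FOUR-FRAME» road under
`stub_DyRamCore` (heir LEAD F0P3a-plan (g18) DIRECTIVE T17-27 D3∕D7; dealer LH4-plan (g10) deal g10-#1 «(ii-0) htr₀-WILD»), 2026-09-03.
-/
import Literature.NumberTheory.Automorphic.UnitaryLatticeTreeSelfDualTransitiveOfTrace      -- ★ htr₀-ram (F0P3a-p07 (g11)): `exists_zpow_smul_single_mem_primitive`, the `σ`-cross-product lemmas `B₀_cross_eq_det`, `B₀_left_cross_eq_zero`, `B₀_right_cross_eq_zero`, `B₀_cross_cross`, `of_mulVec_eq_of_mul_transpose`; brings ★ `isUnimodularLattice_of_isSelfDualLattice`, the `IsUnimodularLattice` API, `det_gram_three`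
import Literature.NumberTheory.Automorphic.UnitaryLatticeTreeResiduallyUnipotentCorner     -- ★ S-a3 helpers (F0P3a-p07 (g11)): `residue_eq_zero_iff_v_lt_one`
import HarnessLib

/-!
# The lattice graph of a hermitian space — htr₀-WILD: `U(σ, J₀)` IS TRANSITIVE ON THE SELF-DUAL VERTICES OF `K³` AT EVERY RAMIFIED PLACE, THE DYADIC ONES INCLUDED
# (Jacobowitz 1962 §9 Prop. 9.1, §10 Prop. 10.3 and the modular classification; O'Meara §82F; Bruhat–Tits 1972 §10)

Topic `NumberTheory/Automorphic`; namespace `Literature.NumberTheory.Automorphic.UnitaryLatticeTree`.  THEOREMS ONLY (no definition, no instance, no notation, no named fact,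
no `sorry`); kernel lane `--supports stmt-HodgeConjecture-24833`.  Cell `pub/hodgecm-mathlib` (D-0151), crux H413 = `stmt-HodgeConjecture-24833`; STAGE 1a «(D-RAM) FOUR-FRAME»
road under `stub_DyRamCore` (LEAD DIRECTIVE T17-27, unit (ii-0) «the wild lattice graph is a tree»), deal g10-#1: the `htr₀` binder of ★ `isTree_latticeGraph_three_of_transitive`
(`UnitaryLatticeTreeFramesOfInvolution` §3) — `∀ L, IsSelfDualLattice σ ϖ J₀ L → ∃ u : U(σ, J₀), L = u·𝒪³` — WITHOUT `|2| = 1`.  The tame twins ★ `…_of_v_two` (B-p14) and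
★ `…_of_trace` (F0P3a-p07) make the partner `y` of a primitive isotropic `f₀` isotropic by `y ↦ y − t·h(y,y)·f₀` with `t + σt = 1`; at a WILDLY ramified place no integral `t`
exists (`Tr 𝒪_E = 𝔭_F^{⌊d∕2⌋} ≠ 𝒪_F`) and a unimodular PLANE need not be hyperbolic (Jacobowitz's `H(0)` versus `[[0,1],[1,a]]`, `a ∉ nH(0)`).  IN RANK THREE the third
direction saves the day: the cross vector `n₁ = J₀(σf₀ × σy)` lies in `M`, is orthogonal to `f₀, y` and has `h(n₁,n₁) = h(f₀,y)h(y,f₀) − h(f₀,f₀)h(y,y) = 1` (Lagrange), so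
`f₂ = y + l·f₀ + m·n₁` is isotropic as soon as `l + σl + mσm = −h(y,y)` — the hypothesis «TRACE + NORM» (TN): EVERY `σ`-FIXED INTEGER IS `Tr λ + N μ` WITH `λ, μ ∈ 𝒪`
(§1, datum-free).  §2 proves (TN) at every ramified place with finite residue field from the conjuncts of the ramified quadratic datum alone (`σ`-fixed elements have even
valuation, `|ϖ − σϖ| = |ϖ|^d`, `d ≥ 1`, `|2| = |ϖ|^t`): `σ` is residually trivial (§2a), so `yσy ≡ y²` and squaring is onto the finite residue field of characteristic `2`
(norm residues, §2b); then a FINITE descent `a = Tr Λₙ + N Yₙ + (ϖσϖ)ⁿcₙ` (the norm is additive modulo traces: `N(μ+ν) = Nμ + Nν + Tr(μσν)`) stopped at `n = t`, where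
`(ϖσϖ)ᵗcₜ = 2e = e + σe` (§2c) — no completeness, no class field theory.  §3 THE HEAD.  This is the rank-3 case of Jacobowitz's splitting `L ≅ L₀ ⊥ H(0) ⊥ …` of a unimodular
lattice of rank `≥ 3` over a ramified dyadic extension (Prop. 10.3) and of the resulting classification of modular lattices by rank, norm and discriminant (odd rank ⇒ `nL = 𝒪`).

* §1 **`cross_mem_of_isSelfDualLattice`** (the `σ`-cross vector of two vectors of a self-dual `M` lies in `M`);
  **`exists_unitary_mapGL_stdLattice_eq_of_isSelfDualLattice_of_trace_add_norm`** (transitivity from (TN), datum-free, `2`-free).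
* §2 **`v_map_sub_self_lt_one_of_even`** (`σ` residually trivial at a ramified place); **`exists_v_sub_mul_map_lt_one`** (norm residues, `|2| < 1`);
  **`exists_trace_add_norm_eq_of_ramified`** ((TN) at a ramified place with finite residue field).
* §3 **`exists_unitary_mapGL_stdLattice_eq_of_isSelfDualLattice_of_ramified`** — THE HEAD «htr₀-WILD» (= the `htr₀` binder of ★ `isTree_latticeGraph_three_of_transitive`, token for token).

HONEST LABEL: HC_CM is proved only modulo the 7 printed citations (2 remaining: hLiu418 = stmt-HodgeConjecture-24832, h413 = stmt-HodgeConjecture-24833) until rung 0 closes;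
nothing printed is asserted here (elementary lattice algebra over a valuation ring with involution); count-neutral support of the (ii-0) unit, no books consequence by itself.

## References
* [Jacobowitz1962] R. Jacobowitz, *Hermitian forms over local fields*, Amer. J. Math. 84 (1962), §4 (unimodular partners), §9 Prop. 9.1 (`[[0,πⁱ],[π̄ⁱ,a]] ≅ H(i)` for
  `a ∈ nH(i)`), §10 Prop. 10.3 (a modular lattice of rank `≥ 3` splits `H(i)`), and the classification of modular lattices over a ramified dyadic extension by rank, norm,
  discriminant (exposition: C.-F. Yu, *On Hermitian forms over dyadic non-maximal local orders*, arXiv:1005.4825 (2010), §2.3, Prop. 2.9, Prop. 2.11, Thm. 2.14).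
* [Omeara1963] O. T. O'Meara, *Introduction to Quadratic Forms* (1963), §82F (82:17) (primitive vectors of unimodular lattices have partners).
* [BruhatTits1972] F. Bruhat, J. Tits, *Groupes réductifs sur un corps local I*, Publ. Math. IHÉS 41 (1972), §10 (special vertices of one type form one orbit).
* [Serre1979] J.-P. Serre, *Local Fields* (1979), Ch. III §6–§7, Ch. V §3 (different and trace of a totally ramified extension; norm residues).
-/

set_option autoImplicit false

noncomputable section

open scoped Valued WithZero Matrix MatrixGroups

namespace Literature.NumberTheory.Automorphic.UnitaryLatticeTree

open Literature.NumberTheory.Automorphic Literature.NumberTheory.Automorphic.HermitianLattice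
open Literature.NumberTheory.Automorphic.CartanUnique

variable {K : Type*} [Field K] [Valued K ℤᵐ⁰] {σ : K →+* K} {ϖ : K}

/-! ## §1 The cross vector lies in a self-dual lattice; self-dual transitivity from «trace + norm» -/

/-- **THE `σ`-CROSS VECTOR OF TWO VECTORS OF A SELF-DUAL LATTICE LIES IN THE LATTICE**: for `M` self-dual (`M = latt g`, `|det g| = 1`, `M^♯ = M`) and `f₀, f₂ ∈ M`,
`n = J₀(σf₀ × σf₂) ∈ M` — since `h(m, n) = σ det(m; f₀; f₂) ∈ det(g)·𝒪` for `m ∈ M`, `n ∈ M^♯`. (Factored out of ★ `…_of_trace`.) [cite: Jacobowitz1962, §4] [cite: Omeara1963, §82F (82:17)] -/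
theorem cross_mem_of_isSelfDualLattice (hvσ : ∀ a, Valued.v (σ a) = Valued.v a) {ϖ' : K} {M : Submodule 𝒪[K] (Fin 3 → K)}
    (hM : IsSelfDualLattice σ ϖ' ((StdForm.antidiagonal 3).over K) M) {f₀ f₂ : Fin 3 → K} (hf₀M : f₀ ∈ M) (hf₂M : f₂ ∈ M) :
    ![σ (f₀ 0) * σ (f₂ 1) - σ (f₀ 1) * σ (f₂ 0), σ (f₀ 2) * σ (f₂ 0) - σ (f₀ 0) * σ (f₂ 2), σ (f₀ 1) * σ (f₂ 2) - σ (f₀ 2) * σ (f₂ 1)] ∈ M := by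
  obtain ⟨g, hMg, -, -, hGdet⟩ := id hM
  rw [pow_zero] at hGdet
  -- `|det g| = 1`
  have hvg : Valued.v (g : Matrix (Fin 3) (Fin 3) K).det = 1 := by
    have h : (formCongr σ g ((StdForm.antidiagonal 3).over K)).det = -(σ (g : Matrix (Fin 3) (Fin 3) K).det * (g : Matrix (Fin 3) (Fin 3) K).det) :=
      det_gram_three (σ := σ) (g : Matrix (Fin 3) (Fin 3) K)
    rw [h, Valuation.map_neg, map_mul, hvσ] at hGdet
    exact eq_one_of_mul_self_eq_one hGdet
  rw [← dualLatt_eq_self_of_isSelfDualLattice hvσ isUnit_det_antidiagonal hM, mem_dualLatt]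
  intro m hm
  rw [pairing_antidiagonal, B₀_cross_eq_det, hvσ]
  -- coordinates: `m = g m′`, `f₀ = g a′`, `f₂ = g b′` with integral `m′, a′, b′`
  rw [hMg] at hm hf₀M hf₂M
  obtain ⟨m', hm', hmeq⟩ := Submodule.mem_map.1 hm
  obtain ⟨a', ha', haeq⟩ := Submodule.mem_map.1 hf₀M
  obtain ⟨b', hb', hbeq⟩ := Submodule.mem_map.1 hf₂M
  rw [LinearMap.restrictScalars_apply, Matrix.toLin'_apply] at hmeq haeq hbeq
  rw [← hmeq, ← haeq, ← hbeq, of_mulVec_eq_of_mul_transpose, Matrix.det_mul, Matrix.det_transpose, map_mul, hvg, mul_one]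
  refine v_det_le_one_of_forall_v_le_one fun i j => ?_
  fin_cases i
  · exact hm' j
  · exact ha' j
  · exact hb' j

set_option maxHeartbeats 800000 in
/-- **`U(σ, J₀)` IS TRANSITIVE ON THE SELF-DUAL VERTICES OF `K³` FROM «TRACE + NORM» — NO DATUM, NO `|2| = 1`.**  `σ` an involution preserving `v`, `ϖ` a uniformiser, and
(TN): every `σ`-fixed `a ∈ 𝒪` is `l + σl + mσm` with `l, m ∈ 𝒪`.  Then every self-dual `M` (for `J₀`, any scaling parameter `ϖ′`) is `u·𝒪³`, `u ∈ U(σ, J₀)`: primitive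
isotropic `f₀ = ϖᵏe₀ ∈ M`, partner `y ∈ M` (`h(f₀,y) = 1`), FIRST cross vector `n₁ = J₀(σf₀ × σy) ∈ M` (`n₁ ⊥ f₀, y`, `h(n₁,n₁) = 1` by Lagrange), ISOTROPIC partner
`f₂ = y + l·f₀ + m·n₁` (`h(f₂,f₂) = h(y,y) + l + σl + mσm = 0`, `h(f₀,f₂) = 1`), second cross vector `n = J₀(σf₀ × σf₂) ∈ M`; `u = (f₀ | n | f₂)` has Gram `J₀`, `u·𝒪³ ≤ M`,
both unimodular ⇒ equal.  ((TN) holds with `m = 0`, `l = ta` when `t + σt = 1`: this contains ★ `…_of_trace`.) [cite: Jacobowitz1962, §10 Prop. 10.3] [cite: Omeara1963, §82F (82:17)] [cite: BruhatTits1972, §10] -/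
theorem exists_unitary_mapGL_stdLattice_eq_of_isSelfDualLattice_of_trace_add_norm (hσ : ∀ x, σ (σ x) = x) (hvσ : ∀ a, Valued.v (σ a) = Valued.v a)
    (hϖ : Valued.v ϖ = WithZero.exp (-1 : ℤ))
    (htn : ∀ a : K, σ a = a → Valued.v a ≤ 1 → ∃ l m : K, Valued.v l ≤ 1 ∧ Valued.v m ≤ 1 ∧ l + σ l + m * σ m = a)
    {ϖ' : K} {M : Submodule 𝒪[K] (Fin 3 → K)} (hM : IsSelfDualLattice σ ϖ' ((StdForm.antidiagonal 3).over K) M) :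
    ∃ u : unitaryGroupOfForm σ ((StdForm.antidiagonal 3).over K), M = mapGL (u : GL (Fin 3) K) (stdLattice K 3) := by
  have hϖ1 : Valued.v ϖ ≤ 1 := by rw [hϖ, ← WithZero.exp_zero]; exact WithZero.exp_le_exp.2 (by norm_num)
  have herm : ∀ y z : Fin 3 → K, B₀ σ 3 z y = σ (B₀ σ 3 y z) := fun y z => (isHermitianForm_B₀ hσ y z).symm
  have hL : IsUnimodularLattice (B₀ σ 3) (frame K 3 Finset.univ) M := isUnimodularLattice_of_isSelfDualLattice hvσ hM
  obtain ⟨g, hMg, -, -, -⟩ := id hM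
  -- the primitive isotropic `f₀ = ϖᵏ e₀ ∈ M` and its partner `y`
  obtain ⟨k, hf₀M, hprim⟩ := exists_zpow_smul_single_mem_primitive hϖ g 0
  rw [← hMg] at hf₀M hprim
  set f₀ : Fin 3 → K := (ϖ ^ k) • (Pi.single 0 1 : Fin 3 → K) with hf₀
  have hf₀f₀ : B₀ σ 3 f₀ f₀ = 0 := by
    rw [hf₀, form_smul_left, form_smul_right, B₀_single_single, if_neg (by decide), mul_zero, mul_zero]
  obtain ⟨y, hyM, hf₀y⟩ := hL.exists_apply_eq_one_of_not_mem' hϖ hvσ (isHermitianForm_B₀ hσ) hf₀M hprim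
  have hyf₀ : B₀ σ 3 y f₀ = 1 := by rw [herm, hf₀y, map_one]
  have hηv : Valued.v (B₀ σ 3 y y) ≤ 1 := hL.integral y hyM y hyM
  have hση : σ (B₀ σ 3 y y) = B₀ σ 3 y y := (isHermitianForm_B₀ hσ).apply_self y
  -- the FIRST cross vector `n₁ = J₀(σf₀ × σy) ∈ M`: `n₁ ⊥ f₀, y`, `h(n₁,n₁) = 1`
  set n₁ : Fin 3 → K := ![σ (f₀ 0) * σ (y 1) - σ (f₀ 1) * σ (y 0), σ (f₀ 2) * σ (y 0) - σ (f₀ 0) * σ (y 2), σ (f₀ 1) * σ (y 2) - σ (f₀ 2) * σ (y 1)] with hn₁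
  have hn₁M : n₁ ∈ M := cross_mem_of_isSelfDualLattice hvσ hM hf₀M hyM
  have hf₀n₁ : B₀ σ 3 f₀ n₁ = 0 := B₀_left_cross_eq_zero f₀ y
  have hyn₁ : B₀ σ 3 y n₁ = 0 := B₀_right_cross_eq_zero f₀ y
  have hn₁f₀ : B₀ σ 3 n₁ f₀ = 0 := by rw [herm, hf₀n₁, map_zero]
  have hn₁y : B₀ σ 3 n₁ y = 0 := by rw [herm, hyn₁, map_zero]
  have hn₁n₁ : B₀ σ 3 n₁ n₁ = 1 := by rw [hn₁, B₀_cross_cross hσ, hf₀y, hyf₀, hf₀f₀]; ring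
  -- «trace + norm»: `l + σl + mσm = −h(y,y)`; the ISOTROPIC partner `f₂ = y + l·f₀ + m·n₁`
  obtain ⟨l, m, hl, hm, hlm⟩ := htn (-B₀ σ 3 y y) (by rw [map_neg, hση]) (by rw [Valuation.map_neg]; exact hηv)
  set f₂ : Fin 3 → K := y + l • f₀ + m • n₁ with hf₂
  have hf₂M : f₂ ∈ M := M.add_mem (M.add_mem hyM (smul_mem_of_v_le _ hl hf₀M)) (smul_mem_of_v_le _ hm hn₁M)
  have hf₀f₂ : B₀ σ 3 f₀ f₂ = 1 := by
    simp only [hf₂, map_add, form_smul_right, hf₀y, hf₀f₀, hf₀n₁, mul_zero, add_zero]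
  have hf₂f₀ : B₀ σ 3 f₂ f₀ = 1 := by rw [herm, hf₀f₂, map_one]
  have hf₂f₂ : B₀ σ 3 f₂ f₂ = 0 := by
    have h : B₀ σ 3 f₂ f₂ = B₀ σ 3 y y + (l + σ l + m * σ m) := by
      simp only [hf₂, map_add, LinearMap.add_apply, form_smul_left, form_smul_right, hyf₀, hf₀y, hf₀f₀, hf₀n₁, hn₁f₀, hyn₁, hn₁y, hn₁n₁]; ring
    rw [h, hlm, add_neg_cancel]
  -- the second cross vector `n = J₀(σf₀ × σf₂) ∈ M`
  set n : Fin 3 → K := ![σ (f₀ 0) * σ (f₂ 1) - σ (f₀ 1) * σ (f₂ 0), σ (f₀ 2) * σ (f₂ 0) - σ (f₀ 0) * σ (f₂ 2), σ (f₀ 1) * σ (f₂ 2) - σ (f₀ 2) * σ (f₂ 1)] with hn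
  have hf₀n : B₀ σ 3 f₀ n = 0 := B₀_left_cross_eq_zero f₀ f₂
  have hf₂n : B₀ σ 3 f₂ n = 0 := B₀_right_cross_eq_zero f₀ f₂
  have hnf₀ : B₀ σ 3 n f₀ = 0 := by rw [herm, hf₀n, map_zero]
  have hnf₂ : B₀ σ 3 n f₂ = 0 := by rw [herm, hf₂n, map_zero]
  have hnn : B₀ σ 3 n n = 1 := by rw [hn, B₀_cross_cross hσ, hf₀f₂, hf₂f₀, hf₀f₀, hf₂f₂]; ring
  have hnM : n ∈ M := cross_mem_of_isSelfDualLattice hvσ hM hf₀M hf₂M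
  -- the unitary matrix `u = (f₀ | n | f₂)`
  set U : Matrix (Fin 3) (Fin 3) K := (Matrix.of ![f₀, n, f₂])ᵀ with hU
  have hU0 : U.mulVec (Pi.single 0 1) = f₀ := transpose_of_mulVec_single _ 0
  have hU1 : U.mulVec (Pi.single 1 1) = n := transpose_of_mulVec_single _ 1
  have hU2 : U.mulVec (Pi.single 2 1) = f₂ := transpose_of_mulVec_single _ 2
  have hUJ : (U.map σ)ᵀ * (StdForm.antidiagonal 3).over K * U = (StdForm.antidiagonal 3).over K := by
    ext i j
    rw [← B₀_mulVec_single_eq_gram, UnitaryGroup.antidiagonal_three_over_eq]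
    fin_cases i <;> fin_cases j <;>
      simp only [Fin.zero_eta, Fin.mk_one, Fin.reduceFinMk, hU0, hU1, hU2, hf₀f₀, hf₀n, hf₀f₂, hnf₀, hnn, hnf₂, hf₂f₀, hf₂n, hf₂f₂] <;> rfl
  have hdetU : U.det ≠ 0 := by
    intro h
    have h2 := congrArg Matrix.det hUJ
    rw [det_gram_three, h, mul_zero, neg_zero, det_antidiagonal_three] at h2
    norm_num at h2
  set u : GL (Fin 3) K := Matrix.GeneralLinearGroup.mkOfDetNeZero U hdetU with hu
  have huval : (u : Matrix (Fin 3) (Fin 3) K) = U := rfl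
  have huU : u ∈ unitaryGroupOfForm σ ((StdForm.antidiagonal 3).over K) := by rw [mem_unitaryGroupOfForm_iff, huval]; exact hUJ
  refine ⟨⟨u, huU⟩, Eq.symm ?_⟩
  change mapGL u (stdLattice K 3) = M
  have hlatt : mapGL u (stdLattice K 3) = latt U := by rw [← latt_one, mapGL_latt_eq, huval, Matrix.mul_one]
  -- `u·𝒪³ ≤ M`
  have hle : mapGL u (stdLattice K 3) ≤ M := by
    rw [hlatt, latt_le_iff_forall_mulVec_single_mem]
    intro j
    fin_cases j
    · simp only [Fin.zero_eta]; rw [hU0]; exact hf₀M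
    · simp only [Fin.mk_one]; rw [hU1]; exact hnM
    · simp only [Fin.reduceFinMk]; rw [hU2]; exact hf₂M
  -- both unimodular ⇒ equal
  have hJ : ∀ i j : Fin 3, (StdForm.antidiagonal 3).over K i j = if j = Fin.rev i then (1 : K) else 0 := by
    intro i j
    simp only [StdForm.over, Matrix.map_apply, StdForm.antidiagonal_J_apply]
    split_ifs <;> simp
  have h0 : IsSelfDualLattice σ ϖ ((StdForm.antidiagonal 3).over K) (mapGL u (stdLattice K 3)) := by
    refine isVertexLattice_mapGL σ ϖ _ u huU (isSelfDualLattice_stdLattice (fun i j => ?_) (fun i j => ?_) ?_ hϖ1)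
    · rw [hJ]; split_ifs <;> simp
    · rw [StdForm.inv_over, hJ]; split_ifs <;> simp
    · rw [det_antidiagonal_three, Valuation.map_neg, map_one]
  exact IsUnimodularLattice.eq_of_le hL (isUnimodularLattice_of_isSelfDualLattice hvσ h0) hle

/-! ## §2 Arithmetic of a ramified quadratic datum: `σ` is residually trivial; norm residues; «trace + norm» -/

/-- **§2a · `σ` IS RESIDUALLY TRIVIAL AT A RAMIFIED PLACE**: if the `σ`-fixed elements have even valuation and `|ϖ − σϖ| = |ϖ|^d` with `d ≥ 1`, then `|σx − x| < 1` for
every `x ∈ 𝒪`.  Write `x = α + βϖ` with `β = (x − σx)∕(ϖ − σϖ)` and `α = x − βϖ`, both `σ`-fixed; `|α|` is even and `|βϖ|` odd, so `|βϖ| ≤ |x| ≤ 1`, i.e. `|β| ≤ exp(1)`,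
hence (evenness) `|β| ≤ 1` and `|σx − x| = |β|·|ϖ|^d ≤ exp(−d) < 1`. [cite: Jacobowitz1962, §9] [cite: Serre1979, Ch. III §6] -/
theorem v_map_sub_self_lt_one_of_even (hσ : ∀ x, σ (σ x) = x) (hϖ : Valued.v ϖ = WithZero.exp (-1 : ℤ))
    (heven : ∀ x : K, σ x = x → x ≠ 0 → ∃ n : ℤ, Valued.v x = WithZero.exp (2 * n)) {d : ℕ}
    (hd : Valued.v (ϖ - σ ϖ) = Valued.v ϖ ^ d) (h1d : 1 ≤ d) {x : K} (hx : Valued.v x ≤ 1) : Valued.v (σ x - x) < 1 := by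
  have hvd : Valued.v (ϖ - σ ϖ) = WithZero.exp (-(d : ℤ)) := by rw [hd, ← map_pow, v_uniformizer_pow hϖ]
  have hδ0 : ϖ - σ ϖ ≠ 0 := fun h => by rw [h, map_zero] at hvd; exact WithZero.coe_ne_zero hvd.symm
  obtain ⟨β, hβδ, hσβ⟩ : ∃ β : K, β * (ϖ - σ ϖ) = x - σ x ∧ σ β = β :=
    ⟨(x - σ x) / (ϖ - σ ϖ), div_mul_cancel₀ _ hδ0, by
      rw [map_div₀, map_sub, map_sub, hσ, hσ, ← neg_sub x (σ x), ← neg_sub ϖ (σ ϖ), neg_div_neg_eq]⟩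
  set α : K := x - β * ϖ with hα
  have hσα : σ α = α := by
    rw [hα, map_sub, map_mul, hσβ]
    linear_combination hβδ
  have hxdec : x = α + β * ϖ := by rw [hα]; ring
  have hsub : σ x - x = -(β * (ϖ - σ ϖ)) := by rw [hβδ, neg_sub]
  by_cases hβ0 : β = 0
  · rw [hsub, hβ0, zero_mul, neg_zero, map_zero]; exact zero_lt_one
  obtain ⟨n, hn⟩ := heven β hσβ hβ0
  -- `|βϖ| ≤ |x| ≤ 1`
  have hβϖ : Valued.v (β * ϖ) = WithZero.exp (2 * n - 1) := by rw [map_mul, hn, hϖ, ← WithZero.exp_add]; ring_nf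
  have hle : Valued.v (β * ϖ) ≤ 1 := by
    by_cases hα0 : α = 0
    · rw [hxdec, hα0, zero_add] at hx; exact hx
    · obtain ⟨m, hm⟩ := heven α hσα hα0
      have hne : Valued.v α ≠ Valued.v (β * ϖ) := by
        rw [hm, hβϖ]
        intro h
        have := WithZero.exp_injective h
        omega
      have hmax := Valuation.map_add_of_distinct_val Valued.v hne
      rw [← hxdec] at hmax
      rw [hmax] at hx
      exact le_trans (le_max_right _ _) hx
  rw [hβϖ, ← WithZero.exp_zero, WithZero.exp_le_exp] at hle
  rw [hsub, Valuation.map_neg, map_mul, hn, hvd, ← WithZero.exp_add, ← WithZero.exp_zero, WithZero.exp_lt_exp]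
  omega

/-- **§2b · NORM RESIDUES AT A DYADIC PLACE**: if `σ` is residually trivial, `|2| < 1` and the residue field is finite, every `b ∈ 𝒪` is a norm modulo `𝔪` — `|b − yσy| < 1`
for some `y ∈ 𝒪` (squaring is injective, hence onto, on the finite residue field of characteristic `2`, and `yσy ≡ y²`). [cite: Jacobowitz1962, §9] [cite: Serre1979, Ch. V §3] -/
theorem exists_v_sub_mul_map_lt_one [Finite 𝓀[K]] (hres : ∀ x : K, Valued.v x ≤ 1 → Valued.v (σ x - x) < 1) (h2 : Valued.v (2 : K) < 1)
    {b : K} (hb : Valued.v b ≤ 1) : ∃ y : K, Valued.v y ≤ 1 ∧ Valued.v (b - y * σ y) < 1 := by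
  -- the residue field has characteristic `2`
  have h20 : (2 : 𝓀[K]) = 0 := by
    have e2 : ((2 : 𝒪[K]) : K) = 2 := by norm_cast
    rw [show (2 : 𝓀[K]) = IsLocalRing.residue 𝒪[K] 2 from (map_ofNat _ 2).symm, residue_eq_zero_iff_v_lt_one, e2]
    exact h2
  -- squaring is injective, hence surjective, on `𝓀[K]`
  have hinj : Function.Injective fun z : 𝓀[K] => z ^ 2 := by
    intro z w h
    have h' : (z - w) ^ 2 = 0 := by
      simp only at h
      linear_combination h + (w ^ 2 - z * w) * h20
    exact sub_eq_zero.1 ((pow_eq_zero_iff two_ne_zero).1 h')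
  obtain ⟨r, hr⟩ := Finite.surjective_of_injective hinj (IsLocalRing.residue 𝒪[K] ⟨b, hb⟩)
  obtain ⟨z, rfl⟩ := IsLocalRing.residue_surjective r
  simp only at hr
  refine ⟨z, z.2, ?_⟩
  -- `z² ≡ b` and `zσz ≡ z²`
  have h1 : Valued.v ((z : K) * z - b) < 1 := by
    have h0 : IsLocalRing.residue 𝒪[K] (z * z - ⟨b, hb⟩) = 0 := by rw [map_sub, map_mul, ← sq, hr, sub_self]
    rw [residue_eq_zero_iff_v_lt_one] at h0
    exact h0
  have h2' : Valued.v ((z : K) * σ z - z * z) < 1 := by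
    rw [show (z : K) * σ z - z * z = (σ z - z) * z by ring, map_mul]
    exact mul_lt_one_of_lt_of_le (hres z z.2) z.2
  rw [show b - (z : K) * σ z = -(((z : K) * σ z - z * z) + (z * z - b)) by ring, Valuation.map_neg]
  exact lt_of_le_of_lt (Valuation.map_add _ _ _) (max_lt h2' h1)

/-- **§2c · «TRACE + NORM» AT A RAMIFIED PLACE WITH FINITE RESIDUE FIELD**: under the conjuncts of the ramified quadratic datum (`σ` an isometric involution, `ϖ` a
uniformiser, `σ`-fixed elements have even valuation, `|ϖ − σϖ| = |ϖ|^d`, `d ≥ 1`, `|2| = |ϖ|^t`), every `σ`-fixed `a ∈ 𝒪` is `l + σl + mσm` with `l, m ∈ 𝒪`.  If `t = 0`: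
`a = a∕2 + σ(a∕2)`.  If `t ≥ 1`: a finite descent `a = l + σl + mσm + Pⁿc` (`P = ϖσϖ`, `c ∈ 𝒪^σ`), the step being `c ≡ yσy (mod 𝔪)` (§2b), `c = yσy + Pc′` (evenness), and
`mσm + (ϖⁿy)σ(ϖⁿy) = N(m + ϖⁿy) − Tr(m·σ(ϖⁿy))`; at `n = t`, `Pᵗc = 2e = e + σe` with `e = Pᵗc∕2 ∈ 𝒪^σ`.  (This is `nL = 𝒪_F ⇒ L ⊇ H(0)` for `L = [[0,1],[1,a]] ⊥ ⟨1⟩`.)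
[cite: Jacobowitz1962, §9 Prop. 9.1 and §10 Prop. 10.3] [cite: Serre1979, Ch. V §3] -/
theorem exists_trace_add_norm_eq_of_ramified [Finite 𝓀[K]] (hσ : ∀ x, σ (σ x) = x) (hvσ : ∀ a, Valued.v (σ a) = Valued.v a)
    (hϖ : Valued.v ϖ = WithZero.exp (-1 : ℤ)) (heven : ∀ x : K, σ x = x → x ≠ 0 → ∃ n : ℤ, Valued.v x = WithZero.exp (2 * n)) {d t : ℕ}
    (hd : Valued.v (ϖ - σ ϖ) = Valued.v ϖ ^ d) (h1d : 1 ≤ d) (h2 : Valued.v (2 : K) = Valued.v ϖ ^ t)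
    {a : K} (ha : σ a = a) (ha1 : Valued.v a ≤ 1) : ∃ l m : K, Valued.v l ≤ 1 ∧ Valued.v m ≤ 1 ∧ l + σ l + m * σ m = a := by
  have hϖ0 : ϖ ≠ 0 := uniformizer_ne_zero hϖ
  have hϖ1 : Valued.v ϖ ≤ 1 := by rw [hϖ, ← WithZero.exp_zero]; exact WithZero.exp_le_exp.2 (by norm_num)
  have hv2t : Valued.v (2 : K) = Valued.v (ϖ ^ t) := by rw [h2, map_pow]
  have h20 : (2 : K) ≠ 0 := fun h => by
    rw [h, map_zero] at hv2t
    exact pow_ne_zero t hϖ0 ((Valuation.zero_iff (Valued.v : Valuation K ℤᵐ⁰)).1 hv2t.symm)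
  have hv20 : Valued.v (2 : K) ≠ 0 := fun h => h20 ((Valuation.zero_iff (Valued.v : Valuation K ℤᵐ⁰)).1 h)
  have hσ2 : σ 2 = 2 := map_ofNat σ 2
  set P : K := ϖ * σ ϖ with hP
  have hσP : σ P = P := by rw [hP, map_mul, hσ, mul_comm]
  have hvP : Valued.v P = WithZero.exp (-2 : ℤ) := by
    rw [hP, map_mul, hvσ, hϖ, ← WithZero.exp_add]; norm_num
  have hP0 : P ≠ 0 := fun h => by rw [h, map_zero] at hvP; exact WithZero.coe_ne_zero hvP.symm
  -- division by `P` of `σ`-fixed elements of `𝔪` (evenness)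
  have hdiv : ∀ c : K, σ c = c → Valued.v c < 1 → Valued.v (c / P) ≤ 1 := by
    intro c hc hc1
    by_cases hc0 : c = 0
    · rw [hc0, zero_div, map_zero]; exact zero_le
    obtain ⟨n, hn⟩ := heven c hc hc0
    rw [hn, ← WithZero.exp_zero, WithZero.exp_lt_exp] at hc1
    rw [map_div₀, hn, hvP, ← WithZero.exp_sub, ← WithZero.exp_zero, WithZero.exp_le_exp]
    omega
  rcases Nat.eq_zero_or_pos t with ht | ht
  · -- `|2| = 1`: `a = a∕2 + σ(a∕2)`
    rw [ht, pow_zero] at h2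
    refine ⟨a / 2, 0, by rw [map_div₀, h2, div_one]; exact ha1, by rw [map_zero]; exact zero_le, ?_⟩
    rw [map_div₀, ha, hσ2, map_zero, mul_zero, add_zero, ← add_div, ← two_mul, mul_div_cancel_left₀ a h20]
  -- `|2| < 1`
  have h2lt : Valued.v (2 : K) < 1 := by
    rw [hv2t, v_uniformizer_pow hϖ, ← WithZero.exp_zero, WithZero.exp_lt_exp]; omega
  have hres : ∀ x : K, Valued.v x ≤ 1 → Valued.v (σ x - x) < 1 := fun x hx => v_map_sub_self_lt_one_of_even hσ hϖ heven hd h1d hx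
  -- the finite descent `a = l + σl + mσm + Pⁿ c`
  have key : ∀ n : ℕ, ∃ l m c : K, Valued.v l ≤ 1 ∧ Valued.v m ≤ 1 ∧ Valued.v c ≤ 1 ∧ σ c = c ∧ a = l + σ l + m * σ m + P ^ n * c := by
    intro n
    induction n with
    | zero => exact ⟨0, 0, a, by rw [map_zero]; exact zero_le, by rw [map_zero]; exact zero_le, ha1, ha, by rw [map_zero, pow_zero]; ring⟩
    | succ n ih =>
      obtain ⟨l, m, c, hl, hm, hc, hσc, hEq⟩ := ih
      obtain ⟨y, hy, hyc⟩ := exists_v_sub_mul_map_lt_one hres h2lt hc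
      have hσc'' : σ (c - y * σ y) = c - y * σ y := by rw [map_sub, map_mul, hσ, hσc, mul_comm]
      set c' : K := (c - y * σ y) / P with hc'
      have hc'1 : Valued.v c' ≤ 1 := hdiv _ hσc'' hyc
      have hσc' : σ c' = c' := by rw [hc', map_div₀, hσc'', hσP]
      have hcc : c = y * σ y + P * c' := by rw [hc', mul_div_cancel₀ _ hP0]; ring
      refine ⟨l - m * σ (ϖ ^ n * y), m + ϖ ^ n * y, c', ?_, ?_, hc'1, hσc', ?_⟩
      · refine le_trans (Valuation.map_sub _ _ _) (max_le hl ?_)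
        rw [map_mul, hvσ, map_mul, map_pow]
        exact mul_le_one' hm (mul_le_one' (pow_le_one' hϖ1 n) hy)
      · refine le_trans (Valuation.map_add _ _ _) (max_le hm ?_)
        rw [map_mul, map_pow]
        exact mul_le_one' (pow_le_one' hϖ1 n) hy
      · rw [hEq, hcc]
        simp only [map_sub, map_add, map_mul, map_pow, hσ, hP]
        ring
  obtain ⟨l, m, c, hl, hm, hc, hσc, hEq⟩ := key t
  -- `Pᵗ c = e + σ e`, `e = Pᵗ c ∕ 2 ∈ 𝒪^σ`
  have hPt : Valued.v (P ^ t) = Valued.v (2 : K) * Valued.v (ϖ ^ t) := by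
    rw [hP, mul_pow, map_mul, map_pow (Valued.v) (σ ϖ), hvσ, ← map_pow, hv2t]
  set e : K := P ^ t * c / 2 with he
  have hve : Valued.v e ≤ 1 := by
    rw [he, map_div₀, map_mul, hPt, mul_assoc, mul_div_cancel_left₀ _ hv20]
    exact mul_le_one' (by rw [map_pow]; exact pow_le_one' hϖ1 t) hc
  have hσe : σ e = e := by rw [he, map_div₀, map_mul, map_pow, hσP, hσc, hσ2]
  have hee : e + e = P ^ t * c := by rw [he, ← add_div, ← two_mul, mul_div_cancel_left₀ _ h20]
  refine ⟨l + e, m, le_trans (Valuation.map_add _ _ _) (max_le hl hve), hm, ?_⟩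
  rw [map_add, hσe, hEq]
  linear_combination hee

/-! ## §3 The head: self-dual transitivity at every ramified place («htr₀-WILD») -/

/-- **«htr₀-WILD»: AT A RAMIFIED PLACE — THE DYADIC ONES INCLUDED — EVERY SELF-DUAL VERTEX OF `(K³, J₀)` IS `u·𝒪³` FOR SOME `u ∈ U(σ, J₀)`.**  Hypotheses ⊆ the conjuncts
of the ramified quadratic datum (`σ` an isometric involution, `ϖ` a uniformiser, `σ`-fixed elements have even valuation, `|ϖ − σϖ| = |ϖ|^d` with `d ≥ 1`, `|2| = |ϖ|^t`) plus a
finite residue field; NO `|2| = 1`, no parity of `d`: tame (`d = 1`, `t = 0`), R-U and R-P alike.  The conclusion is the `htr₀` binder of ★ `isTree_latticeGraph_three_of_transitive`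
(`UnitaryLatticeTreeFramesOfInvolution` §3) token for token; proof = §1 (transitivity from «trace + norm») ∘ §2c.  Printed counterpart: a unimodular hermitian lattice of odd rank
over a ramified dyadic extension has `nL = 𝒪_F` and is classified by rank and discriminant, so all rank-3 self-dual lattices of the split space are isometric. [cite: Jacobowitz1962, §10 Prop. 10.3] [cite: BruhatTits1972, §10] [cite: Omeara1963, §82F (82:17)] -/
theorem exists_unitary_mapGL_stdLattice_eq_of_isSelfDualLattice_of_ramified [Finite 𝓀[K]] (hσ : ∀ x, σ (σ x) = x) (hvσ : ∀ a, Valued.v (σ a) = Valued.v a)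
    (hϖ : Valued.v ϖ = WithZero.exp (-1 : ℤ)) (heven : ∀ x : K, σ x = x → x ≠ 0 → ∃ n : ℤ, Valued.v x = WithZero.exp (2 * n)) {d t : ℕ}
    (hd : Valued.v (ϖ - σ ϖ) = Valued.v ϖ ^ d) (h1d : 1 ≤ d) (h2 : Valued.v (2 : K) = Valued.v ϖ ^ t) :
    ∀ L : Submodule 𝒪[K] (Fin 3 → K), IsSelfDualLattice σ ϖ ((StdForm.antidiagonal 3).over K) L →
      ∃ u : unitaryGroupOfForm σ ((StdForm.antidiagonal 3).over K), L = mapGL (u : GL (Fin 3) K) (stdLattice K 3) :=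
  fun _ hL => exists_unitary_mapGL_stdLattice_eq_of_isSelfDualLattice_of_trace_add_norm hσ hvσ hϖ
    (fun _ ha ha1 => exists_trace_add_norm_eq_of_ramified hσ hvσ hϖ heven hd h1d h2 ha ha1) hL

end Literature.NumberTheory.Automorphic.UnitaryLatticeTree

end
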